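/-
Copyright (c) 2026 the pub-hodgecm-mathlib formalisation cell (harness21).  Prover seat hodgecm-mathlib-K2Liu-p13 (g2), Track B «K2-LIT»,
#184♮ = hLiu418 = `stmt-HodgeConjecture-24832`; Road I v3 organ U1-CT-ind STAGE 2 (Q2), file F5-r (the instance facts `LocallyCompactSpace ∕ SecondCountableTopology N_Q(𝔸)`).
-/
import Summits.HodgeConjecture.HodgeConjecture.Theorems.K2LiuKlingenUnipotentNormal          -- ★ F4-1e: `mem_klingenUnip_iff_entries`
import Summits.HodgeConjecture.HodgeConjecture.Theorems.K2LiuKlingenUnipotentAdelicDefs      -- ★ F4-1: `klingenUnipA`, `jAdelic`, `adelicVal_jAdelic`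
import Literature.NumberTheory.Automorphic.UnitaryGroupOfFormAdelicTopology               -- ★ `locallyCompactSpace_adelic`, `secondCountableTopology_adelic`, `t2Space_adelic`
import Literature.NumberTheory.Automorphic.AdelicUnitaryGroup                              -- ★ `t2Space_adeleRing_of_numberField`
import HarnessLib

/-!
# Crux `HLiu418`, Road I v3, organ U1 stage 2 (Q2), file F5-r: `N_Q(𝔸) ≤ H(𝔸)` IS CLOSED, HENCE LOCALLY COMPACT AND SECOND COUNTABLE —
# the instance facts taken by ★ F5-h ∕ F5-k ∕ F5-q (`[LocallyCompactSpace ↥(klingenUnipA Ψ)]`, `[SecondCountableTopology ↥(klingenUnipA Ψ)]`)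

Cell `hodgecm-mathlib`, crux item hLiu418 = `stmt-HodgeConjecture-24832`; squad K2 ∕ K2Liu; LEAD F0P6-plan (g14), co-dealer K2E5-plan (g7); prover K2Liu-p13 (g2).
THEOREMS ONLY (no `def`, no instance, no notation, no named-fact hypothesis, no `sorry`); lane `--supports stmt-HodgeConjecture-24832 --as helper` (count-neutral).
`N_Q(𝔸) = klingenUnipA Ψ` is the preimage under the continuous `u ↦ adelicVal(Ψ⁻¹ u)` of the eight ENTRY EQUATIONS of ★ F4-1e `mem_klingenUnip_iff_entries`
(`g₀₀ = 1, g₁₀ = g₂₀ = g₃₀ = 0, g₁₁ = 1, g₁₂ = 0, g₂₁ = 0, g₂₂ = 1`), so it is CLOSED in `H(𝔸)`; `H(𝔸) = U(J^𝔻)(𝔸_{L⁺})` is locally compact, second countable and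
Hausdorff (★ `UnitaryGroupOfFormAdelicTopology`), whence the two instance facts — stated as THEOREMS (`haveI := …` at the consumer; no `instance` is declared here).
* `mem_klingenUnipA_iff_symm_mem`, `mem_klingenUnipA_iff_entries`, **`isClosed_klingenUnipA`**, **`locallyCompactSpace_klingenUnipA`**, **`secondCountableTopology_klingenUnipA`**.
[MoeglinWaldspurger1995, I.2.1], [PlatonovRapinchuk1994, §5.1], [WeilBNT1967, Ch. IV §1].
HONEST LABEL.  Count-neutral helper: `HC_CM` is proved only modulo the 7 printed citations (2 remaining named inputs: hLiu418 = `stmt-HodgeConjecture-24832`,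
h413 = `stmt-HodgeConjecture-24833`) until rung 0 closes.
-/

set_option autoImplicit false
set_option linter.dupNamespace false -- the mandated namespace repeats `HodgeConjecture.HodgeConjecture`

noncomputable section

open scoped Matrix
open NumberField IsDedekindDomain Topology

namespace Summit.HodgeConjecture.HodgeConjecture.Cruxes.HLiu418.K2LiuKlingenUnipotentClosed

open Literature.NumberTheory.Automorphic Literature.NumberTheory.Automorphic.UnitaryGroup
open Literature.NumberTheory.GelbartRogawski1991 Literature.NumberTheory.GelbartRogawski1991.GRConstruction
open Literature.NumberTheory.K2Lit.SiegelDoubled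
open Summit.HodgeConjecture.HodgeConjecture.Cruxes.HLiu418.K2LiuDoubledUTwoTwoBorelFrame
open Summit.HodgeConjecture.HodgeConjecture.Cruxes.HLiu418.K2LiuKlingenParabolicDefs
open Summit.HodgeConjecture.HodgeConjecture.Cruxes.HLiu418.K2LiuKlingenUnipotentDefs
open Summit.HodgeConjecture.HodgeConjecture.Cruxes.HLiu418.K2LiuKlingenUnipotentAdelicDefs
open Summit.HodgeConjecture.HodgeConjecture.Cruxes.HLiu418.K2LiuKlingenUnipotentNormal (mem_klingenUnip_iff_entries)
open Summit.HodgeConjecture.HodgeConjecture.Cruxes.HLiu418.K2LiuSiegelDoubledLeviMatrix (conjAdele_conjAdele')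
open UnitaryDualPair

variable {L : Type} [Field L] [NumberField L] [IsCMField L]
variable {N M : ℕ} {e : Fin N × Fin M ≃ Fin 2}
  {dV : Fin N → L} {hdV : ∀ i, IsCMField.complexConj L (dV i) = dV i}
  {dW : Fin M → L} {hdW : ∀ i, IsCMField.complexConj L (dW i) = dW i}

/-- `u ∈ N_Q(𝔸) ↔ jAdelic⁻¹(Ψ⁻¹ u) ∈ klingenUnip 𝔸_L`. [cite: MoeglinWaldspurger1995, I.2.1] -/
theorem mem_klingenUnipA_iff_symm_mem (Ψ : (quasiSplit (Fp L) L (IsCMField.complexConj L) (2 + 2)).Adelic ≃ₜ* HA L e dV hdV dW hdW)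
    (u : HA L e dV hdV dW hdW) :
    u ∈ klingenUnipA Ψ ↔ (jAdelic L 4).symm (Ψ.symm u) ∈
      klingenUnip (AdeleRing (𝓞 L) L) (conjAdele (Fp L) L (IsCMField.complexConj L)) (conjAdele_conjAdele' L) := by
  rw [mem_klingenUnipA_iff]
  constructor
  · rintro ⟨y, hy, z, t, rfl⟩
    rw [ContinuousMulEquiv.symm_apply_apply, MulEquiv.symm_apply_apply]
    exact nKlingen_mem_klingenUnip (conjAdele_conjAdele' L) y hy z t
  · rintro ⟨y, hy, z, t, h⟩
    refine ⟨y, hy, z, t, ?_⟩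
    rw [← h, MulEquiv.apply_symm_apply, ContinuousMulEquiv.apply_symm_apply]

/-- **membership in `N_Q(𝔸)` through the eight entry equations** on the matrix `A = adelicVal(Ψ⁻¹u)` (★ F4-1e). [cite: MoeglinWaldspurger1995, I.2.1] [cite: Xiong2013, §7 Lemma 7.1] -/
theorem mem_klingenUnipA_iff_entries (Ψ : (quasiSplit (Fp L) L (IsCMField.complexConj L) (2 + 2)).Adelic ≃ₜ* HA L e dV hdV dW hdW)
    (u : HA L e dV hdV dW hdW) :
    u ∈ klingenUnipA Ψ ↔
      ((adelicVal (Fp L) L (IsCMField.complexConj L) (2 + 2) _ (Ψ.symm u) : GL (Fin (2 + 2)) (AdeleRing (𝓞 L) L)) : Matrix (Fin (2 + 2)) (Fin (2 + 2)) (AdeleRing (𝓞 L) L)) 0 0 = 1 ∧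
      ((adelicVal (Fp L) L (IsCMField.complexConj L) (2 + 2) _ (Ψ.symm u) : GL (Fin (2 + 2)) (AdeleRing (𝓞 L) L)) : Matrix (Fin (2 + 2)) (Fin (2 + 2)) (AdeleRing (𝓞 L) L)) 1 0 = 0 ∧
      ((adelicVal (Fp L) L (IsCMField.complexConj L) (2 + 2) _ (Ψ.symm u) : GL (Fin (2 + 2)) (AdeleRing (𝓞 L) L)) : Matrix (Fin (2 + 2)) (Fin (2 + 2)) (AdeleRing (𝓞 L) L)) 2 0 = 0 ∧
      ((adelicVal (Fp L) L (IsCMField.complexConj L) (2 + 2) _ (Ψ.symm u) : GL (Fin (2 + 2)) (AdeleRing (𝓞 L) L)) : Matrix (Fin (2 + 2)) (Fin (2 + 2)) (AdeleRing (𝓞 L) L)) 3 0 = 0 ∧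
      ((adelicVal (Fp L) L (IsCMField.complexConj L) (2 + 2) _ (Ψ.symm u) : GL (Fin (2 + 2)) (AdeleRing (𝓞 L) L)) : Matrix (Fin (2 + 2)) (Fin (2 + 2)) (AdeleRing (𝓞 L) L)) 1 1 = 1 ∧
      ((adelicVal (Fp L) L (IsCMField.complexConj L) (2 + 2) _ (Ψ.symm u) : GL (Fin (2 + 2)) (AdeleRing (𝓞 L) L)) : Matrix (Fin (2 + 2)) (Fin (2 + 2)) (AdeleRing (𝓞 L) L)) 1 2 = 0 ∧
      ((adelicVal (Fp L) L (IsCMField.complexConj L) (2 + 2) _ (Ψ.symm u) : GL (Fin (2 + 2)) (AdeleRing (𝓞 L) L)) : Matrix (Fin (2 + 2)) (Fin (2 + 2)) (AdeleRing (𝓞 L) L)) 2 1 = 0 ∧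
      ((adelicVal (Fp L) L (IsCMField.complexConj L) (2 + 2) _ (Ψ.symm u) : GL (Fin (2 + 2)) (AdeleRing (𝓞 L) L)) : Matrix (Fin (2 + 2)) (Fin (2 + 2)) (AdeleRing (𝓞 L) L)) 2 2 = 1 := by
  rw [mem_klingenUnipA_iff_symm_mem, mem_klingenUnip_iff_entries,
    ← adelicVal_jAdelic L 4 ((jAdelic L 4).symm (Ψ.symm u)), MulEquiv.apply_symm_apply]

/-- **`N_Q(𝔸)` IS CLOSED IN `H(𝔸)`** (preimage of the entry equations under the continuous `u ↦ adelicVal(Ψ⁻¹u)`). [cite: MoeglinWaldspurger1995, I.2.1] [cite: PlatonovRapinchuk1994, §5.1] -/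
theorem isClosed_klingenUnipA (Ψ : (quasiSplit (Fp L) L (IsCMField.complexConj L) (2 + 2)).Adelic ≃ₜ* HA L e dV hdV dW hdW) :
    IsClosed ((klingenUnipA Ψ : Subgroup (HA L e dV hdV dW hdW)) : Set (HA L e dV hdV dW hdW)) := by
  have hA : Continuous fun u : HA L e dV hdV dW hdW =>
      (((adelicVal (Fp L) L (IsCMField.complexConj L) (2 + 2) _ (Ψ.symm u)) : GL (Fin (2 + 2)) (AdeleRing (𝓞 L) L)) :
        Matrix (Fin (2 + 2)) (Fin (2 + 2)) (AdeleRing (𝓞 L) L)) :=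
    Units.continuous_val.comp (continuous_subtype_val.comp Ψ.symm.continuous)
  haveI : T2Space (AdeleRing (𝓞 L) L) := t2Space_adeleRing_of_numberField L
  have hset : ((klingenUnipA Ψ : Subgroup (HA L e dV hdV dW hdW)) : Set (HA L e dV hdV dW hdW)) =
      {u | ((adelicVal (Fp L) L (IsCMField.complexConj L) (2 + 2) _ (Ψ.symm u) : GL (Fin (2 + 2)) (AdeleRing (𝓞 L) L)) : Matrix (Fin (2 + 2)) (Fin (2 + 2)) (AdeleRing (𝓞 L) L)) 0 0 = 1} ∩
      {u | ((adelicVal (Fp L) L (IsCMField.complexConj L) (2 + 2) _ (Ψ.symm u) : GL (Fin (2 + 2)) (AdeleRing (𝓞 L) L)) : Matrix (Fin (2 + 2)) (Fin (2 + 2)) (AdeleRing (𝓞 L) L)) 1 0 = 0} ∩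
      {u | ((adelicVal (Fp L) L (IsCMField.complexConj L) (2 + 2) _ (Ψ.symm u) : GL (Fin (2 + 2)) (AdeleRing (𝓞 L) L)) : Matrix (Fin (2 + 2)) (Fin (2 + 2)) (AdeleRing (𝓞 L) L)) 2 0 = 0} ∩
      {u | ((adelicVal (Fp L) L (IsCMField.complexConj L) (2 + 2) _ (Ψ.symm u) : GL (Fin (2 + 2)) (AdeleRing (𝓞 L) L)) : Matrix (Fin (2 + 2)) (Fin (2 + 2)) (AdeleRing (𝓞 L) L)) 3 0 = 0} ∩
      {u | ((adelicVal (Fp L) L (IsCMField.complexConj L) (2 + 2) _ (Ψ.symm u) : GL (Fin (2 + 2)) (AdeleRing (𝓞 L) L)) : Matrix (Fin (2 + 2)) (Fin (2 + 2)) (AdeleRing (𝓞 L) L)) 1 1 = 1} ∩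
      {u | ((adelicVal (Fp L) L (IsCMField.complexConj L) (2 + 2) _ (Ψ.symm u) : GL (Fin (2 + 2)) (AdeleRing (𝓞 L) L)) : Matrix (Fin (2 + 2)) (Fin (2 + 2)) (AdeleRing (𝓞 L) L)) 1 2 = 0} ∩
      {u | ((adelicVal (Fp L) L (IsCMField.complexConj L) (2 + 2) _ (Ψ.symm u) : GL (Fin (2 + 2)) (AdeleRing (𝓞 L) L)) : Matrix (Fin (2 + 2)) (Fin (2 + 2)) (AdeleRing (𝓞 L) L)) 2 1 = 0} ∩
      {u | ((adelicVal (Fp L) L (IsCMField.complexConj L) (2 + 2) _ (Ψ.symm u) : GL (Fin (2 + 2)) (AdeleRing (𝓞 L) L)) : Matrix (Fin (2 + 2)) (Fin (2 + 2)) (AdeleRing (𝓞 L) L)) 2 2 = 1} := by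
    ext u
    simp only [SetLike.mem_coe, mem_klingenUnipA_iff_entries, Set.mem_inter_iff, Set.mem_setOf_eq, and_assoc]
  rw [hset]
  refine ((((((((isClosed_eq (hA.matrix_elem 0 0) continuous_const).inter (isClosed_eq (hA.matrix_elem 1 0) continuous_const)).inter
    (isClosed_eq (hA.matrix_elem 2 0) continuous_const)).inter (isClosed_eq (hA.matrix_elem 3 0) continuous_const)).inter
    (isClosed_eq (hA.matrix_elem 1 1) continuous_const)).inter (isClosed_eq (hA.matrix_elem 1 2) continuous_const)).inter
    (isClosed_eq (hA.matrix_elem 2 1) continuous_const)).inter (isClosed_eq (hA.matrix_elem 2 2) continuous_const))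

/-- **`N_Q(𝔸)` is locally compact** (closed in the locally compact `H(𝔸)`, ★ `locallyCompactSpace_adelic`). [cite: PlatonovRapinchuk1994, §5.1] -/
theorem locallyCompactSpace_klingenUnipA (Ψ : (quasiSplit (Fp L) L (IsCMField.complexConj L) (2 + 2)).Adelic ≃ₜ* HA L e dV hdV dW hdW) :
    LocallyCompactSpace ↥(klingenUnipA Ψ) :=
  (isClosed_klingenUnipA Ψ).locallyCompactSpace

/-- **`N_Q(𝔸)` is second countable** (subspace of the second countable `H(𝔸)`, ★ `secondCountableTopology_adelic`). [cite: WeilBNT1967, Ch. IV §1] -/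
theorem secondCountableTopology_klingenUnipA (Ψ : (quasiSplit (Fp L) L (IsCMField.complexConj L) (2 + 2)).Adelic ≃ₜ* HA L e dV hdV dW hdW) :
    SecondCountableTopology ↥(klingenUnipA Ψ) :=
  TopologicalSpace.Subtype.secondCountableTopology ((klingenUnipA Ψ : Subgroup (HA L e dV hdV dW hdW)) : Set (HA L e dV hdV dW hdW))

end Summit.HodgeConjecture.HodgeConjecture.Cruxes.HLiu418.K2LiuKlingenUnipotentClosed

end
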